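import Summits.CriticalPhenomena.SAWScalingLimit.Theorems.AvoidanceLimit.Negative.AvoidanceLimitWitnessDomains

/-!
# Negative knowledge on crux `AvoidanceLimit`, part 3: reachability in `Ω_δ` is load-bearing

Support file (refuter / cdisprove lane) for the crux
`Summit.CriticalPhenomena.SAWScalingLimit.Theses.SAWLoopFugacityFlow.AvoidanceLimit`
(stmt-CriticalPhenomena-10649, route SAWLoopFugacityFlow, rank 2): for every Dobrushin domain
`(D; a, b)`, hull subdomain `D'`, endpoint approximation, chordal uniformizer `φ`, pulled-back hull
`A = closure (ℍ ∖ φ⁻¹ D')` and restriction data `(Φ, d = Φ'_A(0))`,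
`P_δ(range γ_δ ⊆ closure D') → d^(5/8)` as `δ → 0+`. The crux itself is NOT refuted (it follows from
`SAWScalingLimit`; LSW04 Prediction 1 on avoidance marginals); the `Negative/` files record, as
kernel-checked theorems, which hypotheses any proof MUST use: each variant is the crux with ONE
hypothesis dropped or weakened, everything else verbatim, and each is FALSE.

**`avoidanceLimit_false_without_reachable`** — weaken `IsEndpointApprox D a b` to its two convergence
clauses (`δ a_δ → a`, `δ b_δ → b`), dropping `∀ᶠ δ, Ω_δ.Reachable (a δ) (b δ)`: with `D' = D = bigSq`,
`a_δ = (⌈2/δ⌉₊, 0)`, `b_δ = -a_δ`, the mesh points converge to the marked points `±2` from OUTSIDE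
the open square, the SAW space `DomainSAW` is empty, `SAW.law = 0` (junk value) and
`P_δ(range ⊆ closure D) = 0` for every `δ > 0`, against `Φ'_∅(0)^(5/8) = 1`. Moral: every proof must
route through `IsEndpointApprox.reachable` (it is what makes `SAW.law` eventually a probability
measure; the convergence clauses alone do not even put `a_δ` in `Ω_δ`). [folklore]
-/

noncomputable section

open Set Filter Topology MeasureTheory Complex Metric
open UpperHalfPlane (upperHalfPlaneSet isOpen_upperHalfPlaneSet)
open Literature.Probability.RandomPlanarGeometry Literature.Probability.LatticeModels
open Summit.CriticalPhenomena.SAWScalingLimit.Theses.SAWLoopFugacityFlow (AvoidanceLimit)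

namespace Summit.CriticalPhenomena.SAWScalingLimit.Theorems.AvoidanceLimit.Negative

/-! ### (a) Load-bearing hypothesis: reachability of the endpoints in `Ω_δ` -/


/-- The lattice site `(⌈2/δ⌉₊, 0)`: its mesh point `δ⌈2/δ⌉₊ ∈ [2, 2 + δ)` is just outside the open
square `(-2,2)²` but tends to the marked point `2`. [folklore] -/
def farSite (δ : ℝ) : Site 2 := ![((⌈2 / δ⌉₊ : ℕ) : ℤ), 0]

/-- Its mirror image `(-⌈2/δ⌉₊, 0)`, tending to `-2` from outside. [folklore] -/
def negFarSite (δ : ℝ) : Site 2 := ![-((⌈2 / δ⌉₊ : ℕ) : ℤ), 0]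

/-- The mesh point of the far site is the real number `δ⌈2/δ⌉₊`. [folklore] -/
theorem meshPoint_farSite (δ : ℝ) : meshPoint δ (farSite δ) = ((δ * ⌈2 / δ⌉₊ : ℝ) : ℂ) := by
  apply Complex.ext <;> simp [farSite]

/-- The mesh point of the mirrored far site is `-δ⌈2/δ⌉₊`. [folklore] -/
theorem meshPoint_negFarSite (δ : ℝ) : meshPoint δ (negFarSite δ) = -((δ * ⌈2 / δ⌉₊ : ℝ) : ℂ) := by
  apply Complex.ext <;> simp [negFarSite]

/-- `2 ≤ δ⌈2/δ⌉₊` for `δ > 0`. [folklore] -/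
theorem two_le_mul_ceil {δ : ℝ} (hδ : 0 < δ) : 2 ≤ δ * ⌈2 / δ⌉₊ := by
  have h := Nat.le_ceil (2 / δ)
  calc (2 : ℝ) = δ * (2 / δ) := by field_simp
    _ ≤ δ * ⌈2 / δ⌉₊ := by gcongr

/-- `δ⌈2/δ⌉₊ < 2 + δ` for `δ > 0`. [folklore] -/
theorem mul_ceil_lt {δ : ℝ} (hδ : 0 < δ) : δ * ⌈2 / δ⌉₊ < 2 + δ := by
  have h := Nat.ceil_lt_add_one (show (0 : ℝ) ≤ 2 / δ by positivity)
  calc δ * ⌈2 / δ⌉₊ < δ * (2 / δ + 1) := by gcongr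
    _ = 2 + δ := by field_simp

/-- The far mesh points converge to the marked point `2` as `δ → 0+`. [folklore] -/
theorem tendsto_meshPoint_farSite :
    Tendsto (fun δ ↦ meshPoint δ (farSite δ)) (𝓝[>] 0) (𝓝 (2 : ℂ)) := by
  simp only [meshPoint_farSite]
  rw [show (2 : ℂ) = ((2 : ℝ) : ℂ) by norm_num]
  refine (Complex.continuous_ofReal.tendsto 2).comp ?_
  rw [Metric.tendsto_nhdsWithin_nhds]
  intro ε hε
  refine ⟨ε, hε, fun {δ} hδ hd ↦ ?_⟩
  rw [Real.dist_eq, abs_lt]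
  rw [Real.dist_eq, sub_zero, abs_of_pos hδ] at hd
  have h1 := two_le_mul_ceil hδ
  have h2 := mul_ceil_lt hδ
  constructor <;> linarith

/-- The mirrored far mesh points converge to `-2` as `δ → 0+`. [folklore] -/
theorem tendsto_meshPoint_negFarSite :
    Tendsto (fun δ ↦ meshPoint δ (negFarSite δ)) (𝓝[>] 0) (𝓝 (-2 : ℂ)) := by
  simp only [meshPoint_negFarSite, ← meshPoint_farSite]
  exact tendsto_meshPoint_farSite.neg

/-- The two far sites are distinct (`⌈2/δ⌉₊ ≥ 1`). [folklore] -/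
theorem farSite_ne_negFarSite {δ : ℝ} (hδ : 0 < δ) : farSite δ ≠ negFarSite δ := by
  intro h
  have h0 := congrFun h 0
  simp only [farSite, negFarSite, Matrix.cons_val_zero] at h0
  have hpos : 0 < ⌈2 / δ⌉₊ := Nat.ceil_pos.2 (by positivity)
  omega

/-- No vertex of `Ω_δ` sits at the far site: its mesh point is outside the open square. [folklore] -/
theorem farSite_notMem_meshVertices {δ : ℝ} (hδ : 0 < δ) : farSite δ ∉ meshVertices (symRect 2 2) δ := by
  rw [mem_meshVertices_iff, meshPoint_farSite, mem_symRect]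
  rintro ⟨⟨-, h⟩, -⟩
  rw [Complex.ofReal_re] at h
  linarith [two_le_mul_ceil hδ]

/-- There is no SAW of `Ω_δ` from the far site (it is an isolated vertex of `discreteDomainGraph`). [folklore] -/
theorem isEmpty_domainSAW_far {δ : ℝ} (hδ : 0 < δ) :
    IsEmpty (SAW.DomainSAW (symRect 2 2) δ (farSite δ) (negFarSite δ)) := by
  refine ⟨fun γ ↦ ?_⟩
  obtain ⟨w, hadj, -, -⟩ := γ.walk.exists_eq_cons_of_ne (farSite_ne_negFarSite hδ)
  exact farSite_notMem_meshVertices hδ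
    (meshDomain_subset_meshVertices _ _ (discreteDomainGraph_adj_iff.1 hadj).2.1)

/-- Hence the critical SAW law from the far sites is the zero measure (junk value of `SAW.law`). [folklore] -/
theorem law_far_eq_zero {δ : ℝ} (hδ : 0 < δ) :
    SAW.law (symRect 2 2) δ (farSite δ) (negFarSite δ) = 0 := by
  haveI := isEmpty_domainSAW_far hδ
  exact Measure.eq_zero_of_isEmpty _

/-- The crux with `IsEndpointApprox D a b` WEAKENED to its two convergence clauses (the reachability
clause `∀ᶠ δ, Ω_δ.Reachable (a δ) (b δ)` dropped). -/
def AvoidanceLimitWithoutReachable : Prop :=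
  ∀ (D D' : DobrushinDomain) (a b : ℝ → Site 2),
    Tendsto (fun δ ↦ meshPoint δ (a δ)) (𝓝[>] 0) (𝓝 (D.pt 0)) →
    Tendsto (fun δ ↦ meshPoint δ (b δ)) (𝓝[>] 0) (𝓝 (D.pt 1)) →
    D'.carrier ⊆ D.carrier → D'.pt 0 = D.pt 0 → D'.pt 1 = D.pt 1 →
    (∃ ε : ℝ, 0 < ε ∧ D'.carrier ∩ Metric.ball (D.pt 0) ε = D.carrier ∩ Metric.ball (D.pt 0) ε ∧
      D'.carrier ∩ Metric.ball (D.pt 1) ε = D.carrier ∩ Metric.ball (D.pt 1) ε) →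
    ∀ (φ : ConformalEquiv upperHalfPlaneSet D.carrier), D.IsChordalUniformizing φ →
    ∀ (A : Set ℂ), A = closure (upperHalfPlaneSet \ {z | z ∈ upperHalfPlaneSet ∧ φ z ∈ D'.carrier}) →
    ∀ (Φ : ConformalEquiv (upperHalfPlaneSet \ A) upperHalfPlaneSet) (d : ℝ),
      IsRestrictionMap A Φ → HasRestrictionDeriv A Φ d →
      Tendsto (fun δ => ((SAW.law D.carrier δ (a δ) (b δ)).map (fun γ => γ.curve))
        (CurveClass.rangeSubset (closure D'.carrier))) (𝓝[>] 0)
        (𝓝 (ENNReal.ofReal (d ^ ((5 : ℝ) / 8))))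

/-- **Reachability in `Ω_δ` is load-bearing** (even with `δ a_δ → a`, `δ b_δ → b` kept). Witness:
`D = D' = bigSq`, `a_δ = (⌈2/δ⌉₊, 0)`, `b_δ = -a_δ`: the mesh points converge to the marked points
`±2` from OUTSIDE the open square, the SAW space is empty, `SAW.law = 0` (junk value) and
`P_δ(range ⊆ closure D) = 0` for every `δ > 0`, against the value `Φ'_∅(0)^(5/8) = 1`.
Moral: every proof must route through `IsEndpointApprox.reachable` to know that `SAW.law` is
(eventually) a probability measure; the convergence clauses alone do not even put `a_δ` in `Ω_δ`. [folklore] -/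
theorem avoidanceLimit_false_without_reachable : ¬ AvoidanceLimitWithoutReachable := by
  intro h
  obtain ⟨φ, hφ⟩ := MarkedDomain.exists_isChordalUniformizing_holds bigSq
  have ha : Tendsto (fun δ ↦ meshPoint δ (farSite δ)) (𝓝[>] 0) (𝓝 (bigSq.pt 0)) := by
    rw [bigSq_pt_zero]; exact tendsto_meshPoint_farSite
  have hb : Tendsto (fun δ ↦ meshPoint δ (negFarSite δ)) (𝓝[>] 0) (𝓝 (bigSq.pt 1)) := by
    rw [bigSq_pt_one]; exact tendsto_meshPoint_negFarSite
  have key := h bigSq bigSq farSite negFarSite ha hb subset_rfl rfl rfl ⟨1, one_pos, rfl, rfl⟩ φ hφ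
    ∅ (empty_eq_pullback_self φ) restrictionMapEmpty 1 isRestrictionMap_empty hasRestrictionDeriv_empty
  have h0 : Tendsto (fun δ : ℝ ↦ ((SAW.law bigSq.carrier δ (farSite δ) (negFarSite δ)).map
      (fun γ ↦ γ.curve)) (CurveClass.rangeSubset (closure bigSq.carrier))) (𝓝[>] 0) (𝓝 0) := by
    refine tendsto_const_nhds.congr' ?_
    filter_upwards [self_mem_nhdsWithin] with δ hδ
    rw [bigSq_carrier, law_far_eq_zero hδ, Measure.map_zero, Measure.coe_zero, Pi.zero_apply]
  have := tendsto_nhds_unique key h0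
  rw [Real.one_rpow, ENNReal.ofReal_one] at this
  exact one_ne_zero this

end Summit.CriticalPhenomena.SAWScalingLimit.Theorems.AvoidanceLimit.Negative

end
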